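import Summits.QuantumFields.YangMills.Theorems.LuscherReductionDressedRitzLiftLeakageBasisGenericL
import Summits.QuantumFields.YangMills.Theorems.LuscherReductionDressedRitzPolyakovLiftTransplantRootR
import HarnessLib

/-!
# Crux `DressedRitz` (stmt-QuantumFields-20205), line «polyakovlift» r7, stub S-LEAK `stub_liftLeakage` — support XXV:
# the r7 text `∀ k, LeakageForL (TransplantBasisLR k)` BY NAME, and r7 ⟹ r6

Support module (fleet seat ym-20205-polyakovlift-s1 gen 3; `--supports stmt-QuantumFields-20205`, helper, no closure claim).  Skeleton r7 of the line
(LEAD ym-lead-20205-polyakovlift g2, REGISTERED 2026-08-27T20:37Z, sha16 b06d67d4467729f8: «radius floor re-pinned», four stubs) re-keys the three RG stubs verbatim from the r6 predicate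
`TransplantBasisL k L Λ g` (`1/8 ≤ RΛ ≤ 1/4`, p554989) to `TransplantBasisLR k L Λ g` (`1 ≤ R⁴Λ`, `RΛ ≤ 1/4`, p566907 `…PolyakovLiftTransplantRootR.lean`), so
S-LEAK reads `Stmt.stub_liftLeakage := ∀ k, LeakageForL (TransplantBasisLR k)`.  The closing package of support XXIV (`…LiftLeakageBasisGenericL.lean`,
p556891) is PARAMETRIC in the basis predicate, so the r7 row is an instantiation:

* §1 ★★★ `r7Leakage_of_firstMomentCoreForL : (∀ k, FirstMomentCoreForL (TransplantBasisLR k)) → ∀ k, LeakageForL (TransplantBasisLR k)` (= the REGISTERED r7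
  `Stmt.stub_liftLeakage` after unfolding the `abbrev`; members physical by `basisPhysL_transplantBasisLR`), `r7Leakage_of_slowOutsideCoreForL`,
  `r7Leakage_iff_euclidean` (E4), `r7Leakage_of_imp` (sub-predicates — any further pin of the radius, any symmetry-adapted sub-class — inherit);
* §2 ★ `r6Leakage_of_r7Leakage` — **the r7 text implies the r6 text**: for `Λ ≤ 1/16` every r6 basis (`RΛ ≥ 1/8`) is an r7 basis (`R⁴Λ ≥ 1/(4096Λ³) ≥ 1`,
  `transplantBasisLR_of_transplantBasisL`), and `LeakageForL` only reads `Λ = λ(β,L) ≤ 2·lam` eventually (`leakageForL_of_imp_window`: antitone in `P` under an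
  implication valid for small `Λ` only).  So r7's S-LEAK is the STRONGER obligation (larger class of cut-off radii, down to `Λ^{−1/4}`); the located reading is
  unchanged: per member (NEAR₁) `O(λ²/L)` band admixture budget + (BAND) `O(λ/L)λ₀` + (OUT) `L`-uniform `O(λ³)` out-of-band weight of the undressed insertion —
  the smaller radius only makes the cut-off admixture `poly(1/Λ)·e^{−Λ^{−1/4}} ≪ λ³`, inside (OUT) (cdisprove R7-PREVET V1).

HONEST FRAMING: quantifier plumbing at fixed lattice on the conditional femto rung R2b1; the registered `stub_liftLeakage` stays OPEN (RG estimate, not in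
print); nothing here bears on infinite volume, the continuum limit or the Clay gap.
References: M. Lüscher, NPB 219 (1983) 233 [cite: Luscher1983, §3]; M. Lüscher, U. Wolff, NPB 339 (1990) 222 [cite: LuscherWolff1990, §2].
-/

set_option autoImplicit false

noncomputable section

open MeasureTheory Filter Topology Finset
open Literature.MathematicalPhysics.QuantumFieldTheory
open Literature.MathematicalPhysics.QuantumLattice
open scoped BigOperators

namespace Summit.QuantumFields.YangMills.Theorems.FemtoTransferGap.LiftLeak

open Summit.QuantumFields.YangMills.Theorems.FemtoTransferGap
open Summit.QuantumFields.YangMills.Theorems.FemtoTransferGap.PolyakovLift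

/-! ## §1 The r7 S-LEAK text `∀ k, LeakageForL (TransplantBasisLR k)` by name -/

/-- ★★★ **`(∀ k, FirstMomentCoreForL (TransplantBasisLR k)) → ∀ k, LeakageForL (TransplantBasisLR k)`** — the r7 text of `Stmt.stub_liftLeakage` from the
per-member first-moment core ((NEAR₁) + (BAND) + (OUT) on the undressed insertion); members physical by `basisPhysL_transplantBasisLR`.
[cite: Luscher1983, §3] [cite: LuscherWolff1990, §2] -/
theorem r7Leakage_of_firstMomentCoreForL (h : ∀ k : ℕ, FirstMomentCoreForL (TransplantBasisLR k)) :
    ∀ k : ℕ, LeakageForL (TransplantBasisLR k) :=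
  fun k => leakageForL_of_firstMomentCoreForL (basisPhysL_transplantBasisLR k) (h k)

/-- ★★ **`(∀ k, SlowOutsideCoreForL (TransplantBasisLR k)) → ∀ k, LeakageForL (TransplantBasisLR k)`** (second-moment form of the core).
[cite: Luscher1983, §3] [cite: LuscherWolff1990, §2] -/
theorem r7Leakage_of_slowOutsideCoreForL (h : ∀ k : ℕ, SlowOutsideCoreForL (TransplantBasisLR k)) :
    ∀ k : ℕ, LeakageForL (TransplantBasisLR k) :=
  fun k => leakageForL_of_slowOutsideCoreForL (basisPhysL_transplantBasisLR k) (h k)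

/-- ★ **The r7 text in Euclidean currency** (E4): `(∀ k, LeakageForL (TransplantBasisLR k)) ↔ ∀ k, EuclideanLeakageForL (TransplantBasisLR k)` — the
log-convexity defect of the normalised connected autocorrelation of the root-transplanted flowed-Polyakov insertion at separation `2L+1` is `≤ C(λ³/L²)` relative.
[cite: LuscherWolff1990, §2] -/
theorem r7Leakage_iff_euclidean :
    (∀ k : ℕ, LeakageForL (TransplantBasisLR k)) ↔ ∀ k : ℕ, EuclideanLeakageForL (TransplantBasisLR k) :=
  forall_congr' fun k => leakageForL_iff_euclideanForL (basisPhysL_transplantBasisLR k)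

/-- **Sub-predicates inherit the r7 text** (a further pinned radius, a symmetry-adapted sub-class of eigenfamilies, …). [cite: Luscher1983, §3] -/
theorem r7Leakage_of_imp {Q : (k : ℕ) → ℕ → ℝ → (Fin k → (GaugeConfig 3 1 SU2 → ℝ)) → Prop}
    (hQ : ∀ k L Λ g, Q k L Λ g → TransplantBasisLR k L Λ g) (h : ∀ k : ℕ, LeakageForL (TransplantBasisLR k)) :
    ∀ k : ℕ, LeakageForL (Q k) :=
  fun k => leakageForL_of_imp (hQ k) (h k)

/-! ## §2 r7 ⟹ r6: the re-pinned floor enlarges the class of radii for small `Λ` -/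

variable {k : ℕ}

/-- **`LeakageForL` is antitone in the predicate under an implication valid for SMALL `Λ` only**: if every `P`-basis at `0 < Λ ≤ Λ₀` is a `P'`-basis, then
`LeakageForL P' → LeakageForL P` (shrink `lam0` to `min lam0 (Λ₀/2)`; the text only reads `Λ = λ(β,L) ∈ [lam, 2·lam]`). [cite: Luscher1983, §3] -/
theorem leakageForL_of_imp_window {P P' : ℕ → ℝ → (Fin k → (GaugeConfig 3 1 SU2 → ℝ)) → Prop} {Λ₀ : ℝ} (hΛ₀ : 0 < Λ₀)
    (hPP' : ∀ L Λ g, 0 < Λ → Λ ≤ Λ₀ → P L Λ g → P' L Λ g) (h : LeakageForL P') : LeakageForL P := by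
  obtain ⟨C, lam0, hC, hlam0, hk⟩ := h
  refine ⟨C, min lam0 (Λ₀ / 2), hC, lt_min hlam0 (by positivity), fun lam hlam hle => ?_⟩
  obtain ⟨L0, hL⟩ := hk lam hlam (hle.trans (min_le_left _ _))
  refine ⟨L0, fun L _ hL0 β hW φ hφ g hg => hL L hL0 β hW φ hφ g (hPP' _ _ _ ?_ ?_ hg)⟩
  · exact lt_of_lt_of_le hlam hW.2.1
  · have h2 : lam ≤ Λ₀ / 2 := hle.trans (min_le_right _ _)
    linarith [hW.2.2]

/-- **An r6 basis is an r7 basis for `0 < Λ ≤ 1/16`**: `RΛ ≥ 1/8` gives `(RΛ)⁴ ≥ 1/4096 ≥ Λ³`, i.e. `R⁴Λ ≥ 1`. [cite: Luscher1983, §3] -/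
theorem transplantBasisLR_of_transplantBasisL (k L : ℕ) {Λ : ℝ} (hΛ : 0 < Λ) (hΛ16 : Λ ≤ 1 / 16) (g : Fin k → (GaugeConfig 3 1 SU2 → ℝ))
    (hg : TransplantBasisL k L Λ g) : TransplantBasisLR k L Λ g := by
  obtain ⟨f, R, hf, hpos, hR1, hlo, hhi, hgi⟩ := hg
  refine ⟨f, R, hf, hpos, hR1, ?_, hhi, hgi⟩
  have h4 : (1 / 8 : ℝ) ^ 4 ≤ (R * Λ) ^ 4 := pow_le_pow_left₀ (by norm_num) hlo 4
  have hΛ3 : Λ ^ 3 ≤ (1 / 16 : ℝ) ^ 3 := pow_le_pow_left₀ hΛ.le hΛ16 3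
  have e : (R * Λ) ^ 4 = R ^ 4 * Λ * Λ ^ 3 := by ring
  rw [e] at h4
  by_contra hlt
  have hlt' : R ^ 4 * Λ < 1 := not_le.1 hlt
  have hΛ3pos : 0 < Λ ^ 3 := pow_pos hΛ 3
  have : R ^ 4 * Λ * Λ ^ 3 < 1 * Λ ^ 3 := mul_lt_mul_of_pos_right hlt' hΛ3pos
  norm_num at h4 hΛ3
  linarith

/-- ★ **r7's S-LEAK implies r6's S-LEAK**: `(∀ k, LeakageForL (TransplantBasisLR k)) → ∀ k, LeakageForL (TransplantBasisL k)` — the re-pinned floor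
`R ≥ Λ^{−1/4}` only ENLARGES the class of admissible cut-off radii eventually in the window, so the r7 obligation is the stronger one (same constants, `lam0`
shrunk below `1/32`). [cite: Luscher1983, §3] [cite: LuscherWolff1990, §2] -/
theorem r6Leakage_of_r7Leakage (h : ∀ k : ℕ, LeakageForL (TransplantBasisLR k)) : ∀ k : ℕ, LeakageForL (TransplantBasisL k) :=
  fun k => leakageForL_of_imp_window (P' := TransplantBasisLR k) (by norm_num : (0 : ℝ) < 1 / 16)
    (fun L Λ g hΛ hΛ16 hg => transplantBasisLR_of_transplantBasisL k L hΛ hΛ16 g hg) (h k)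

/-- The r7 first-moment core likewise implies the r6 one's CONCLUSION: `(∀ k, FirstMomentCoreForL (TransplantBasisLR k)) → ∀ k, LeakageForL (TransplantBasisL k)`.
[cite: Luscher1983, §3] -/
theorem r6Leakage_of_firstMomentCoreForLR (h : ∀ k : ℕ, FirstMomentCoreForL (TransplantBasisLR k)) :
    ∀ k : ℕ, LeakageForL (TransplantBasisL k) :=
  r6Leakage_of_r7Leakage (r7Leakage_of_firstMomentCoreForL h)

end Summit.QuantumFields.YangMills.Theorems.FemtoTransferGap.LiftLeak

end
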